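import Mathlib.Analysis.Complex.ExponentialBounds
import Mathlib.Analysis.Real.Pi.Bounds
import Literature.NumberTheory.LFunctions.DeBruijnPhiDeriv
import HarnessLib

/-!
# The Pólya–de Bruijn kernel `Φ`: the second derivative and the series in `y_n = πn²e^{4u}`

Topic `Literature/NumberTheory/LFunctions`; companion of `DeBruijnPhiDeriv.lean` (which proves
`Φ′ = deBruijnPhiDeriv = 30E_{2,2}(2·) − 15E_{1,1}(2·) − 8E_{3,3}(2·)` for the tree's Rodgers–Tao-normalised
kernel `Φ = deBruijnPhi`). This file is the toolbox of `DeBruijnPhiDecreasing.lean` (Wintner's theorem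
`Φ′ < 0` on `(0, ∞)`); everything is proved:

* `deBruijnPhiDeriv₂` and `hasDerivAt_deBruijnPhiDeriv`: `Φ″ = 330E_{2,2} − 224E_{3,3} − 75E_{1,1} + 32E_{4,4}`
  (at `2u`), by the tree's `E_{j,k}′ = (1/2 + 2j)E_{j,k} − 2E_{j+1,k+1}`;
* the ONE-SERIES forms in the frequencies `y_n = thetaFreq x n = π(n+1)²x`, `x = e^{4u}`:
  `Φ′(u) = −eᵘ ∑_n y_n(8y_n² − 30y_n + 15)e^{−y_n}` (`deBruijnPhiDeriv_eq_tsum`) and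
  `Φ″(u) = eᵘ ∑_n y_n(32y_n³ − 224y_n² + 330y_n − 75)e^{−y_n}` (`deBruijnPhiDeriv₂_eq_tsum`), through the
  generic term `phiPolyTerm a₁ a₂ a₃ a₄ x n = (a₁y + a₂y² + a₃y³ + a₄y⁴)e^{−y}`, `y = y_n(x)`;
* the numerical constants used there, from Mathlib's digits `3.14 < π < 3.15`,
  `2.7182818283 < e < 2.7182818286`, `log 2 < 0.6931471808`: `e^π > 23`, `e^{2π} > 512`,
  `e^{3.29} < 28`, `e^{1/24} ≤ 24/23`, and the tail weight `y⁴e^{−y} ≤ 50e^{−y/2}` for `y ≥ 4π`.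

## References

* E. C. Titchmarsh, *The Theory of the Riemann Zeta-Function*, 2nd ed. (1986), §10.1. [Titchmarsh1986]
* J. C. Lagarias, D. Montague, *The integral of the Riemann ξ-function* (2011), Lemma 3.1. [LagariasMontague2011]
-/

noncomputable section

open Filter Topology Set
open scoped Real

namespace Literature.NumberTheory.LFunctions

/-! ## 1. The second derivative `Φ″` -/

/-- The second derivative of `Φ`:
`Φ″(u) = 330 E_{2,2}(2u) − 224 E_{3,3}(2u) − 75 E_{1,1}(2u) + 32 E_{4,4}(2u)`. [folklore] -/
def deBruijnPhiDeriv₂ (u : ℝ) : ℝ :=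
  330 * expThetaMoment 2 2 (2 * u) - 224 * expThetaMoment 3 3 (2 * u) -
    75 * expThetaMoment 1 1 (2 * u) + 32 * expThetaMoment 4 4 (2 * u)

/-- `Φ′` is differentiable with derivative `Φ″ = deBruijnPhiDeriv₂` (term-by-term, via
`E_{j,k}′ = (1/2 + 2j)E_{j,k} − 2E_{j+1,k+1}`). [folklore] -/
theorem hasDerivAt_deBruijnPhiDeriv (u : ℝ) :
    HasDerivAt deBruijnPhiDeriv (deBruijnPhiDeriv₂ u) u := by
  have h2 : HasDerivAt (fun u : ℝ => 2 * u) 2 u := by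
    simpa using (hasDerivAt_id u).const_mul (2 : ℝ)
  have hA := ((hasDerivAt_expThetaMoment 2 2 (2 * u)).comp u h2).const_mul 30
  have hB := ((hasDerivAt_expThetaMoment 1 1 (2 * u)).comp u h2).const_mul 15
  have hC := ((hasDerivAt_expThetaMoment 3 3 (2 * u)).comp u h2).const_mul 8
  have h := (hA.sub hB).sub hC
  have ef : deBruijnPhiDeriv = fun u => 30 * expThetaMoment 2 2 (2 * u) -
      15 * expThetaMoment 1 1 (2 * u) - 8 * expThetaMoment 3 3 (2 * u) := rfl
  have e : 30 * (((1 / 2 + 2 * ((2 : ℕ) : ℝ)) * expThetaMoment 2 2 (2 * u) -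
      2 * expThetaMoment (2 + 1) (2 + 1) (2 * u)) * 2) -
      15 * (((1 / 2 + 2 * ((1 : ℕ) : ℝ)) * expThetaMoment 1 1 (2 * u) -
      2 * expThetaMoment (1 + 1) (1 + 1) (2 * u)) * 2) -
      8 * (((1 / 2 + 2 * ((3 : ℕ) : ℝ)) * expThetaMoment 3 3 (2 * u) -
      2 * expThetaMoment (3 + 1) (3 + 1) (2 * u)) * 2) = deBruijnPhiDeriv₂ u := by
    simp only [deBruijnPhiDeriv₂, Nat.cast_ofNat, Nat.cast_one]
    norm_num
    ring
  rw [ef, ← e]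
  exact h

/-- `deriv Φ′ = Φ″`. [folklore] -/
theorem deriv_deBruijnPhiDeriv : deriv deBruijnPhiDeriv = deBruijnPhiDeriv₂ :=
  funext fun u => (hasDerivAt_deBruijnPhiDeriv u).deriv

/-! ## 2. The series for `Φ′` and `Φ″` in the variable `y_n = π n² e^{4u}` -/

/-- The frequencies `y_n(x) := π (n+1)² x` (so `y_n(e^{4u})` is the exponent of the `n`-th theta term).
[folklore] -/
def thetaFreq (x : ℝ) (n : ℕ) : ℝ := π * ((n : ℝ) + 1) ^ 2 * x

/-- The generic term `(a₁ y + a₂ y² + a₃ y³ + a₄ y⁴) e^{−y}` at `y = y_n(x)`. [folklore] -/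
def phiPolyTerm (a₁ a₂ a₃ a₄ x : ℝ) (n : ℕ) : ℝ :=
  (a₁ * thetaFreq x n + a₂ * thetaFreq x n ^ 2 + a₃ * thetaFreq x n ^ 3 + a₄ * thetaFreq x n ^ 4) *
    rexp (-thetaFreq x n)

/-- `y_n(x) ≥ π x` for `x ≥ 0`. [folklore] -/
theorem pi_mul_le_thetaFreq {x : ℝ} (hx : 0 ≤ x) (n : ℕ) : π * x ≤ thetaFreq x n := by
  unfold thetaFreq
  have h1 : (1 : ℝ) ≤ ((n : ℝ) + 1) ^ 2 := by nlinarith [(n.cast_nonneg : (0 : ℝ) ≤ n)]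
  nlinarith [Real.pi_pos, mul_nonneg Real.pi_pos.le hx]

/-- `y_{n+1}(x) ≥ 4π x` for `x ≥ 0` (the terms from the second on). [folklore] -/
theorem four_pi_mul_le_thetaFreq_succ {x : ℝ} (hx : 0 ≤ x) (n : ℕ) :
    4 * π * x ≤ thetaFreq x (n + 1) := by
  unfold thetaFreq
  have h1 : (4 : ℝ) ≤ (((n + 1 : ℕ) : ℝ) + 1) ^ 2 := by
    push_cast; nlinarith [(n.cast_nonneg : (0 : ℝ) ≤ n)]
  nlinarith [Real.pi_pos, mul_nonneg Real.pi_pos.le hx]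

/-- `x^k · (π(n+1)²)^k e^{−π(n+1)²x} = y_n^k e^{−y_n}`: the theta-moment terms in the variable `y_n`.
[folklore] -/
theorem pow_mul_thetaMomentTerm (k : ℕ) (x : ℝ) (n : ℕ) :
    x ^ k * thetaMomentTerm k x n = thetaFreq x n ^ k * rexp (-thetaFreq x n) := by
  unfold thetaMomentTerm thetaFreq
  rw [mul_pow (π * ((n : ℝ) + 1) ^ 2) x k,
    show -π * ((n : ℝ) + 1) ^ 2 * x = -(π * ((n : ℝ) + 1) ^ 2 * x) by ring]
  ring

/-- The generic term is a combination of theta-moment terms. [folklore] -/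
theorem phiPolyTerm_eq (a₁ a₂ a₃ a₄ x : ℝ) (n : ℕ) :
    phiPolyTerm a₁ a₂ a₃ a₄ x n = a₁ * (x ^ 1 * thetaMomentTerm 1 x n) +
      a₂ * (x ^ 2 * thetaMomentTerm 2 x n) + a₃ * (x ^ 3 * thetaMomentTerm 3 x n) +
      a₄ * (x ^ 4 * thetaMomentTerm 4 x n) := by
  simp only [pow_mul_thetaMomentTerm, phiPolyTerm]
  ring

/-- The generic series converges for `x > 0`. [folklore] -/
theorem summable_phiPolyTerm (a₁ a₂ a₃ a₄ : ℝ) {x : ℝ} (hx : 0 < x) :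
    Summable (phiPolyTerm a₁ a₂ a₃ a₄ x) := by
  have h : ∀ k : ℕ, ∀ a : ℝ, Summable fun n => a * (x ^ k * thetaMomentTerm k x n) := fun k a =>
    ((summable_thetaMomentTerm k hx).mul_left (x ^ k)).mul_left a
  exact ((((h 1 a₁).add (h 2 a₂)).add (h 3 a₃)).add (h 4 a₄)).congr fun n =>
    (phiPolyTerm_eq a₁ a₂ a₃ a₄ x n).symm

/-- The generic series sums to `a₁ x ψ₁(x) + a₂ x² ψ₂(x) + a₃ x³ ψ₃(x) + a₄ x⁴ ψ₄(x)`. [folklore] -/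
theorem tsum_phiPolyTerm (a₁ a₂ a₃ a₄ : ℝ) {x : ℝ} (hx : 0 < x) :
    ∑' n, phiPolyTerm a₁ a₂ a₃ a₄ x n = a₁ * (x ^ 1 * thetaMoment 1 x) +
      a₂ * (x ^ 2 * thetaMoment 2 x) + a₃ * (x ^ 3 * thetaMoment 3 x) +
      a₄ * (x ^ 4 * thetaMoment 4 x) := by
  have h : ∀ k : ℕ, ∀ a : ℝ, Summable fun n => a * (x ^ k * thetaMomentTerm k x n) := fun k a =>
    ((summable_thetaMomentTerm k hx).mul_left (x ^ k)).mul_left a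
  have e : ∀ k : ℕ, ∀ a : ℝ, ∑' n, a * (x ^ k * thetaMomentTerm k x n) = a * (x ^ k * thetaMoment k x) :=
    fun k a => by rw [tsum_mul_left, tsum_mul_left, thetaMoment]
  rw [tsum_congr (phiPolyTerm_eq a₁ a₂ a₃ a₄ x),
    ((h 1 a₁).add (h 2 a₂) |>.add (h 3 a₃)).tsum_add (h 4 a₄),
    ((h 1 a₁).add (h 2 a₂)).tsum_add (h 3 a₃), (h 1 a₁).tsum_add (h 2 a₂), e, e, e, e]

/-- `E_{k,k}(2u) = eᵘ · x^k ψ_k(x)` with `x = e^{4u}`. [folklore] -/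
theorem expThetaMoment_two_mul (k : ℕ) (u : ℝ) :
    expThetaMoment k k (2 * u) = rexp u * (rexp (4 * u) ^ k * thetaMoment k (rexp (4 * u))) := by
  unfold expThetaMoment
  have e1 : rexp ((1 / 2 + 2 * (k : ℝ)) * (2 * u)) = rexp u * rexp (4 * u) ^ k := by
    rw [← Real.exp_nat_mul, ← Real.exp_add]
    congr 1
    ring
  have e2 : rexp (2 * (2 * u)) = rexp (4 * u) := by congr 1; ring
  rw [e1, e2]
  ring

/-- **`Φ′` as one series**: `Φ′(u) = −eᵘ ∑_n y_n (8y_n² − 30y_n + 15) e^{−y_n}`, `y_n = π(n+1)²e^{4u}`.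
[folklore] -/
theorem deBruijnPhiDeriv_eq_tsum (u : ℝ) :
    deBruijnPhiDeriv u = -(rexp u * ∑' n, phiPolyTerm 15 (-30) 8 0 (rexp (4 * u)) n) := by
  rw [tsum_phiPolyTerm _ _ _ _ (Real.exp_pos _), deBruijnPhiDeriv, expThetaMoment_two_mul,
    expThetaMoment_two_mul, expThetaMoment_two_mul]
  ring

/-- **`Φ″` as one series**: `Φ″(u) = eᵘ ∑_n y_n (32y_n³ − 224y_n² + 330y_n − 75) e^{−y_n}`. [folklore] -/
theorem deBruijnPhiDeriv₂_eq_tsum (u : ℝ) :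
    deBruijnPhiDeriv₂ u = rexp u * ∑' n, phiPolyTerm (-75) 330 (-224) 32 (rexp (4 * u)) n := by
  rw [tsum_phiPolyTerm _ _ _ _ (Real.exp_pos _), deBruijnPhiDeriv₂, expThetaMoment_two_mul,
    expThetaMoment_two_mul, expThetaMoment_two_mul, expThetaMoment_two_mul]
  ring

/-! ## 3. Numerical constants -/

/-- `e^π > 23` (from `e > 2.7182818283`, `π > 3.14`, `e^{0.14} ≥ 1 + 0.14 + 0.14²/2`). [folklore] -/
theorem wintner_exp_pi_gt : 23 < rexp π := by
  have e3 : rexp 3 = rexp 1 ^ 3 := by rw [← Real.exp_nat_mul]; norm_num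
  have h1 : rexp 1 ^ 3 * (1 + 0.14 + 0.14 ^ 2 / 2) ≤ rexp 3.14 := by
    rw [show (3.14 : ℝ) = 3 + 0.14 by norm_num, Real.exp_add, e3]
    exact mul_le_mul_of_nonneg_left (Real.quadratic_le_exp_of_nonneg (by norm_num)) (by positivity)
  have h2 : (23 : ℝ) < rexp 1 ^ 3 * (1 + 0.14 + 0.14 ^ 2 / 2) := by
    have h := Real.exp_one_gt_d9
    have h3 : (2.7182818283 : ℝ) ^ 3 ≤ rexp 1 ^ 3 := by gcongr
    nlinarith
  have h3 : rexp 3.14 < rexp π := Real.exp_lt_exp.2 Real.pi_gt_d2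
  linarith

/-- `e^{−π} < 1/23`. [folklore] -/
theorem wintner_exp_neg_pi_lt : rexp (-π) < 1 / 23 := by
  rw [Real.exp_neg, inv_eq_one_div]
  exact one_div_lt_one_div_of_lt (by norm_num) wintner_exp_pi_gt

/-- `e^{2π} > 512 = 2⁹` (from `log 2 < 0.6931471808` and `π > 3.14`). [folklore] -/
theorem wintner_exp_two_pi_gt : 512 < rexp (2 * π) := by
  have h1 : rexp (9 * Real.log 2) = 512 := by
    rw [show (9 : ℝ) * Real.log 2 = ((9 : ℕ) : ℝ) * Real.log 2 by norm_num, Real.exp_nat_mul,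
      Real.exp_log two_pos]
    norm_num
  have h2 : 9 * Real.log 2 < 2 * π := by
    have := Real.log_two_lt_d9
    have := Real.pi_gt_d2
    linarith
  rw [← h1]
  exact Real.exp_lt_exp.2 h2

/-- `e^{3.29} < 28` (from `e < 2.7182818286` and `e^{0.29} ≤ 1 + 0.29 + 0.29²`). [folklore] -/
theorem wintner_exp_329_lt : rexp 3.29 < 28 := by
  have e3 : rexp 3 = rexp 1 ^ 3 := by rw [← Real.exp_nat_mul]; norm_num
  have h1 : rexp 0.29 ≤ 1 + 0.29 + 0.29 ^ 2 := by
    have h := Real.abs_exp_sub_one_sub_id_le (x := (0.29 : ℝ)) (by rw [abs_of_pos (by norm_num)]; norm_num)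
    have := (abs_le.1 h).2
    linarith
  have h2 : rexp 1 ^ 3 < 20.0856 := by
    have := Real.exp_one_lt_d9
    calc rexp 1 ^ 3 < 2.7182818286 ^ 3 := by gcongr
      _ < 20.0856 := by norm_num
  rw [show (3.29 : ℝ) = 3 + 0.29 by norm_num, Real.exp_add, e3]
  calc rexp 1 ^ 3 * rexp 0.29 ≤ rexp 1 ^ 3 * (1 + 0.29 + 0.29 ^ 2) := by gcongr
    _ < 20.0856 * (1 + 0.29 + 0.29 ^ 2) := by gcongr
    _ < 28 := by norm_num

/-- `e^{1/24} ≤ 24/23` (from `1 − 1/24 ≤ e^{−1/24}`). [folklore] -/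
theorem wintner_exp_one_div_24_le : rexp (1 / 24) ≤ 24 / 23 := by
  have h := Real.add_one_le_exp (-(1 / 24) : ℝ)
  rw [Real.exp_neg] at h
  have hpos := Real.exp_pos (1 / 24 : ℝ)
  have h2 : (-(1 / 24) + 1) * rexp (1 / 24) ≤ (rexp (1 / 24))⁻¹ * rexp (1 / 24) :=
    mul_le_mul_of_nonneg_right h hpos.le
  rw [inv_mul_cancel₀ hpos.ne'] at h2
  linarith

/-- **The polynomial–exponential bound for the tail**: `y⁴ e^{−y} ≤ 50 e^{−y/2}` for `y ≥ 4π`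
(with `t = y/4π ≥ 1`: `t ≤ e^{t−1}` gives `t⁴ ≤ e^{4(t−1)} ≤ e^{2π(t−1)} = e^{y/2 − 2π}`, and
`(4π)⁴ e^{−2π} < 25205/512 < 50`). [folklore] -/
theorem wintner_pow_four_mul_exp_neg_le {y : ℝ} (hy : 4 * π ≤ y) : y ^ 4 * rexp (-y) ≤ 50 * rexp (-y / 2) := by
  have hπ := Real.pi_pos
  have h4π : 0 < 4 * π := by positivity
  set t := y / (4 * π) with ht
  have hy' : y = 4 * π * t := by rw [ht]; field_simp
  have ht1 : 1 ≤ t := by rw [ht, le_div_iff₀ h4π]; linarith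
  have ht0 : 0 ≤ t := zero_le_one.trans ht1
  have h1 : t ≤ rexp (t - 1) := by have := Real.add_one_le_exp (t - 1); linarith
  have h2 : t ^ 4 ≤ rexp (y / 2 - 2 * π) := by
    calc t ^ 4 ≤ rexp (t - 1) ^ 4 := by gcongr
      _ = rexp (4 * (t - 1)) := by rw [← Real.exp_nat_mul]; norm_num
      _ ≤ rexp (y / 2 - 2 * π) := Real.exp_le_exp.2 (by
          have h3 : 4 * (t - 1) ≤ 2 * π * (t - 1) := by nlinarith [Real.pi_gt_three]
          have e : 2 * π * (t - 1) = y / 2 - 2 * π := by rw [hy']; ring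
          linarith)
  have h3 : (4 * π) ^ 4 * rexp (-(2 * π)) ≤ 50 := by
    have hp : (4 * π) ^ 4 < 25205 := by
      have := Real.pi_lt_d2
      calc (4 * π) ^ 4 < (4 * 3.15) ^ 4 := by gcongr
        _ < 25205 := by norm_num
    have he : rexp (-(2 * π)) < 1 / 512 := by
      rw [Real.exp_neg, inv_eq_one_div]
      exact one_div_lt_one_div_of_lt (by norm_num) wintner_exp_two_pi_gt
    have := mul_lt_mul'' hp he (by positivity) (by positivity)
    linarith [show (25205 : ℝ) * (1 / 512) ≤ 50 by norm_num]
  calc y ^ 4 * rexp (-y) = (4 * π) ^ 4 * t ^ 4 * rexp (-y) := by rw [hy']; ring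
    _ ≤ (4 * π) ^ 4 * rexp (y / 2 - 2 * π) * rexp (-y) := by gcongr
    _ = (4 * π) ^ 4 * rexp (-(2 * π)) * rexp (-y / 2) := by
        rw [mul_assoc, mul_assoc, ← Real.exp_add, ← Real.exp_add]
        congr 2
        ring
    _ ≤ 50 * rexp (-y / 2) := by gcongr

end Literature.NumberTheory.LFunctions

end
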